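import Literature.Barriers.CriticalPhenomena.WeaklySAWFlowAffineFamily
import Literature.Barriers.CriticalPhenomena.WeaklySAWFlowBaseLipschitz
import Literature.Barriers.CriticalPhenomena.WeaklySAWFlowContinuity
import Mathlib.Analysis.Calculus.Deriv.Shift
import HarnessLib

/-!
# [BBS-rg-flow, Theorem 1.4(ii)] = BBS 2015, Theorem 7.2.1(ii): the critical flow is differentiable
# in `g₀`, with `∂z₀/∂g₀ = O(1)`, `∂μ₀/∂g₀ = O(1)`

File of the series formalising [BBS-rg-flow] (Bauerschmidt–Brydges–Slade, AHP 16 (2015),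
arXiv:1211.2477) towards `Literature.Barriers.CriticalPhenomena.WeaklySAWFourDimLogCorrections`:
part (ii) of Theorem 1.4, the input of BBS 2015, Proposition 7.1.1 through its Theorem 7.2.1(ii)
("`z₀ᶜ, μ₀ᶜ` … continuously differentiable in `g₀` … `∂ν₀ᶜ/∂g₀ = O(1)`, `∂z₀ᶜ/∂g₀ = O(1)`");
continuation of `WeaklySAWFlowAffineFamily.lean` (the affine family `T̃_p`, its fixed point `affFix p`
and `hasStrictDerivAt_affFix`), `WeaklySAWFlowBaseLipschitz.lean` (transfer of the bounds between nearby
base points) and `WeaklySAWFlowContinuity.lean` (`critFlow`, the flow of Theorem 1.4(i) at admissible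
points).
* `marginHyp_of_thresholds`: the thresholds `𝗁_*`, `g_*` of Theorem 1.4(i) give the contraction not
  only at level `b` but at every level `β ∈ [b, min(1, 2b)]`, with the margin `(1-θ₀)(β-b)` for the
  affine perturbation (`θ₀ = (1+κΩ)/2`), and `κϑ ≤ θ₀`;
* `critFlow_eq_physX_affFix`: for `g₀ < g_*` (and the smallness `8B²C_{2,0}g₀ < 1` of Lemma 2.3), for
  `g` near `g₀` the critical flow `x(m, K₀, g)` of Theorem 1.4(i) IS, scale by scale, the physical point
  of the fixed point `affFix (g - g₀)` of the affine family at the frozen base point `g₀` (transfer of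
  the bounds to level `β = min((1+b)/2, 2b)`, `Ttil_eq_of_flow`, uniqueness of the fixed point);
* **`hasDerivAt_critFlow`** (Theorem 1.4(ii), differentiability): every `x_j(m, K₀, ·)` is
  differentiable at `g₀`, with derivative `physXL_j(v_j)`, `v` the derivative of `affFix` at `0`;
* **`abs_deriv_critFlow_zero_le`** (Theorem 1.4(ii), (1.15)): `|∂z₀/∂g₀|, |∂μ₀/∂g₀| ≤ 2K_e/(1-κΩ)`,
  a constant depending only on the constants of (A1)–(A3) (uniform in `g₀` and in the external
  parameter), from `‖v‖ ≤ ‖E‖/(1-θ₀) ≤ K_e/((1-θ₀)𝗁g₀²|log g₀|)` and `𝗐_{z,0} = 𝗁χ₀g₀²|log g₀|`.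
The `C¹` (continuity of the derivative) and the joint `(K₀, g₀)`-differentiability of the printed
statement are not addressed here (TODO(general form)); BBS 2015 uses `K₀ = 𝟙_∅` fixed and the bounds.

## References
* R. Bauerschmidt, D. C. Brydges, G. Slade, *Structural stability of a dynamical system near a
  non-hyperbolic fixed point*, Ann. Henri Poincaré 16 (2015), arXiv:1211.2477: Theorem 1.4(ii), (1.15),
  Remark 1.5, §3.4 (proof of Theorem 1.4(ii)), Lemma 3.4. [BauerschmidtBrydgesSlade2015Flow]
* R. Bauerschmidt, D. C. Brydges, G. Slade, CMP 338 (2015), arXiv:1403.7422, Theorem 7.2.1(ii) and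
  Proposition 7.1.1. [BauerschmidtBrydgesSlade2015LogCorr]
-/

noncomputable section

open Filter Topology Set
open scoped BigOperators ENNReal NNReal

namespace Literature.Barriers.CriticalPhenomena

namespace CTWSAW

/-! ## The thresholds of Theorem 1.4(i) give the contraction at every level `β ∈ [b, min(1,2b)]`,
with a margin -/

set_option maxHeartbeats 800000 in
/-- **The thresholds `𝗁 ≥ 𝗁_*`, `g₀ ≤ g_*` of Theorem 1.4(i) at a higher level with margin**: under the
hypotheses of `BBS_thm14_exists_flow`, for every `β` with `b ≤ β ≤ 2b`, `β ≤ 1`: (A1)–(A2) packaged at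
`g₀` (`CutoffQuadHyp`), the ball data at levels `b` and `β`, the smallness `SmallHyp` at level `b` with
`θ₀ = (1+κΩ)/2`, the smallness WITH MARGIN `(1-θ₀)(β-b)` at level `β` (`MarginHyp`) for `S = S̄_{𝒱𝒱}`, and
`κϑ ≤ θ₀` (the same arithmetic as in the proof of Theorem 1.4(i): `‖S‖lipN(β) ≤ 3/8 ≤ θ₀`,
`‖S‖M/𝗁 ≤ (1-θ₀)b`). [cite: BauerschmidtBrydgesSlade2015Flow, Theorem 1.4 ("there exists h_* … there exists g_*") and Remark 1.5] -/
theorem marginHyp_of_thresholds {Ω B c lam C a κ R M aStar b : ℝ} (hΩ : 1 < Ω)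
    (hκ : 0 < κ) (hκΩ : κ * Ω < 1) (hR : 0 < R) (hM : 0 < M) (haStar : R / (1 - κ * Ω) < aStar) (ha : aStar < a)
    (hb : 0 < b) (hb1 : b < 1) (hh : ℝ) (hhh : hThreshold Ω c C lam M a aStar κ b ≤ hh)
    {W : ℕ → Type*} [∀ j, NormedAddCommGroup (W j)] [∀ j, NormedSpace ℝ (W j)]
    (P : QuadFlowParams) (ψ : ∀ j, W j × V3 → W (j + 1)) (ρ : ∀ j, W j × V3 → V3) {g₀ : ℝ} {K₀ : W 0}
    (hA1 : HypA1 P.β Ω B c) (hA2 : HypA2 P Ω lam c C) (hg₀ : 0 < g₀)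
    (hgs : g₀ ≤ gThreshold Ω B c C lam M a aStar κ R b hh)
    (hA3 : HypA3 (chi P.β Ω) ψ ρ (P.flow g₀) a hh κ Ω R M) (hK₀ : ‖K₀‖ ≤ aStar * g₀ ^ 3)
    {β : ℝ} (hbβ : b ≤ β) (hβ2 : β ≤ 2 * b) (hβ1 : β ≤ 1) :
    ∃ h : CutoffQuadHyp P Ω (jOmega P.β Ω) B c ⌊c⁻¹⌋₊ C lam g₀,
      ∃ hB : CutoffQuadHyp.BallHyp P ψ Ω (jOmega P.β Ω) g₀ hh a aStar b K₀,
      ∃ _hBβ : CutoffQuadHyp.BallHyp P ψ Ω (jOmega P.β Ω) g₀ hh a aStar β K₀,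
        CutoffQuadHyp.SmallHyp Ω B C g₀ κ M hh (a - aStar) b ((1 + κ * Ω) / 2) (h.sbarVP hB.small1 hB.hh_pos) ∧
        MarginHyp Ω B C g₀ κ M hh (a - aStar) β ((1 + κ * Ω) / 2) (h.sbarVP hB.small1 hB.hh_pos)
          ((1 - (1 + κ * Ω) / 2) * (β - b)) ∧
        κ * stepRatio Ω B g₀ ≤ (1 + κ * Ω) / 2 := by
  -- constants
  set C' : ℝ := sbarConst Ω c ⌊c⁻¹⌋₊ C lam * (27 / 8) with hC'
  set aK : ℝ := a - aStar with haK_def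
  set q₀ : ℝ := ratioMargin Ω κ R aStar with hq₀
  set θ₀ : ℝ := (1 + κ * Ω) / 2 with hθ₀
  have hΩ0 : 0 < Ω := by linarith
  have h1κ : 0 < 1 - κ * Ω := by linarith
  have haK : 0 < aK := by rw [haK_def]; linarith
  have ha0 : 0 < aStar := lt_trans (div_pos hR h1κ) haStar
  have hB : 0 ≤ B := hA1.B_nonneg
  -- thresholds for `𝗁`
  have hh1 : 1 ≤ hh := (le_max_left _ _).trans hhh
  have hh0 : 0 < hh := by linarith
  have hhA : 16 * C' * M * aK * Ω ≤ hh := ((le_max_left _ _).trans (le_max_right _ _)).trans hhh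
  have hhB : 2 * C' * M / ((1 - κ * Ω) * b) ≤ hh := ((le_max_right _ _).trans (le_max_right _ _)).trans hhh
  -- thresholds for `g₀`
  have hgq : g₀ ≤ quadThreshold Ω B c C lam :=
    hgs.trans ((min_le_left _ _).trans ((min_le_left _ _).trans (min_le_left _ _)))
  have hge : g₀ ≤ Real.exp (-2) / 4 :=
    hgs.trans ((min_le_left _ _).trans ((min_le_left _ _).trans (min_le_right _ _)))
  have hgr : g₀ ≤ (1 - q₀⁻¹) / (6 * B + 1) := hgs.trans ((min_le_left _ _).trans (min_le_right _ _))
  have hg3 : g₀ ≤ ((1 - κ * Ω) * aK / (64 * M * hh)) ^ 2 := hgs.trans ((min_le_right _ _).trans (min_le_left _ _))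
  have hg4 : g₀ ≤ (1 / (8 * (C' + 1) * (512 * (2 * B + 14 * C) * Ω * hh * b + 8 * M))) ^ 2 / 2 :=
    hgs.trans ((min_le_right _ _).trans (min_le_right _ _))
  -- (A1)–(A2) ⇒ the hypotheses of Lemmas 2.1–2.2 at the cut-off `j_Ω`
  obtain ⟨h, -, -⟩ := cutoffQuadHyp_of_hypA hΩ hA1 hA2 hg₀ hgq
  have hC : 0 ≤ C := h.C_nonneg
  have hC'0 : 0 ≤ C' := mul_nonneg h.sbarConst_nonneg (by norm_num)
  have hA3' : HypA3 (cutoffWeight Ω (jOmega P.β Ω)) ψ ρ (P.flow g₀) a hh κ Ω R M := hA3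
  -- smallness of `g₀`: exponential thresholds
  have he2 : Real.exp (-2) ≤ Real.exp (-1) := Real.exp_le_exp.2 (by norm_num)
  have he1 : Real.exp (-2) ≤ 1 := by rw [← Real.exp_zero]; exact Real.exp_le_exp.2 (by norm_num)
  have hsmall1 : 4 * g₀ ≤ Real.exp (-1) := by linarith
  have hsmall2 : 2 * g₀ ≤ Real.exp (-2) := by linarith [Real.exp_pos (-2)]
  have hg1 : g₀ ≤ 1 := by linarith [Real.exp_pos (-2)]
  have h2g1 : 2 * g₀ ≤ 1 := by linarith
  -- the one-step ratio `ϑ ≤ Ωq₀`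
  have hq1 : 1 < q₀ := one_lt_ratioMargin hΩ0 hκ hκΩ hR haStar
  have hq0 : 0 < q₀ := by linarith
  have hcube : ((1 - 2 * B * g₀)⁻¹) ^ 3 ≤ q₀ := by
    refine inv_cube_le_of_small hB hg₀.le hq1.le ?_
    have h6 : 0 < 6 * B + 1 := by positivity
    have h7 := (le_div_iff₀ h6).1 hgr
    have e : g₀ * (6 * B + 1) = 6 * B * g₀ + g₀ := by ring
    linarith [hg₀.le]
  have hϑ : stepRatio Ω B g₀ ≤ Ω * q₀ := mul_le_mul_of_nonneg_left hcube hΩ0.le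
  have hϑ0 : 0 ≤ stepRatio Ω B g₀ := h.stepRatio_nonneg
  have hq2 : q₀ ≤ 2 := (min_le_left _ _).trans (min_le_left _ _)
  have hqR : q₀ ≤ (aStar - R) / (κ * aStar * Ω) := (min_le_left _ _).trans (min_le_right _ _)
  have hqκ : q₀ ≤ 1 + (1 - κ * Ω) / (4 * (κ * Ω)) := min_le_right _ _
  have hϑ2 : stepRatio Ω B g₀ ≤ 2 * Ω :=
    calc stepRatio Ω B g₀ ≤ Ω * q₀ := hϑ
      _ ≤ Ω * 2 := mul_le_mul_of_nonneg_left hq2 hΩ0.le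
      _ = 2 * Ω := by ring
  have hϑR : R + κ * aStar * stepRatio Ω B g₀ ≤ aStar := by
    have hpos : 0 < κ * aStar * Ω := by positivity
    have h1 : q₀ * (κ * aStar * Ω) ≤ aStar - R := (le_div_iff₀ hpos).1 hqR
    have h2 : κ * aStar * stepRatio Ω B g₀ ≤ κ * aStar * (Ω * q₀) :=
      mul_le_mul_of_nonneg_left hϑ (by positivity)
    have h3 : κ * aStar * (Ω * q₀) = q₀ * (κ * aStar * Ω) := by ring
    linarith
  have hϑκ : κ * stepRatio Ω B g₀ ≤ κ * Ω + (1 - κ * Ω) / 4 := by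
    have hkΩ : 0 < κ * Ω := by positivity
    calc κ * stepRatio Ω B g₀ ≤ κ * (Ω * q₀) := mul_le_mul_of_nonneg_left hϑ hκ.le
      _ = κ * Ω * q₀ := by ring
      _ ≤ κ * Ω * (1 + (1 - κ * Ω) / (4 * (κ * Ω))) := mul_le_mul_of_nonneg_left hqκ hkΩ.le
      _ = κ * Ω + (1 - κ * Ω) / 4 := by field_simp
  -- Lemma 1.3 along `x̄` and the ball data
  have hχ : ∀ j, 0 ≤ cutoffWeight Ω (jOmega P.β Ω) j := fun j => (h.weight_pos j).le
  have hgb : ∀ j, 0 ≤ P.flow g₀ j 0 := fun j => by rw [QuadFlowParams.flow_apply_zero]; exact (h.gbar_pos j).le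
  have hKbar : ∀ j, ‖Kbar ψ (P.flow g₀) K₀ j‖ ≤ aStar * cutoffWeight Ω (jOmega P.β Ω) j * gbar P.β g₀ j ^ 3 := by
    intro j
    have hratio : ∀ j, cutoffWeight Ω (jOmega P.β Ω) j * P.flow g₀ j 0 ^ 3 ≤
        stepRatio Ω B g₀ * (cutoffWeight Ω (jOmega P.β Ω) (j + 1) * P.flow g₀ (j + 1) 0 ^ 3) := fun j => by
      simpa [QuadFlowParams.flow_apply_zero, stepRatio] using h.toCutoffGbarHyp.weight_cube_le_mul_succ j
    have hK₀' : ‖K₀‖ ≤ aStar * cutoffWeight Ω (jOmega P.β Ω) 0 * P.flow g₀ 0 0 ^ 3 := by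
      rw [cutoffWeight_eq_one_of_le (by simp), QuadFlowParams.flow_apply_zero, gbar_zero]; simpa using hK₀
    have := hA3'.norm_Kbar_le hχ hgb hh0.le ha0.le ha.le hratio hϑR hK₀' j
    simpa [QuadFlowParams.flow_apply_zero] using this
  have hBall : CutoffQuadHyp.BallHyp P ψ Ω (jOmega P.β Ω) g₀ hh a aStar b K₀ :=
    ⟨hh0, hb, hb1.le, ha0.le, ha, hKbar, hsmall1, hsmall2⟩
  -- the solution operator and its norm
  set S := h.sbarVP hBall.small1 hBall.hh_pos with hS_def
  have hSn : ‖S‖ ≤ C' := h.norm_sbarVP_le hBall.small1 hBall.hh_pos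
  -- `ε`-bounds
  have hε1 : epsLog g₀ ≤ 2 * Real.sqrt g₀ := epsLog_le_sqrt hg₀ hg1
  have hε2 : epsLogSq g₀ ≤ 32 * Real.sqrt g₀ := by
    have h16 := epsLogSq_le_sqrt hg₀ h2g1
    have : Real.sqrt (2 * g₀) ≤ 2 * Real.sqrt g₀ := by
      rw [Real.sqrt_le_left (by positivity)]
      nlinarith [Real.sq_sqrt hg₀.le, Real.sqrt_nonneg g₀]
    linarith
  have hε10 := h.epsLog_nonneg; have hε20 := h.epsLogSq_nonneg
  have hsg0 : 0 ≤ Real.sqrt g₀ := Real.sqrt_nonneg _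
  have hsq3 : Real.sqrt g₀ ≤ (1 - κ * Ω) * aK / (64 * M * hh) := by
    have hx : 0 ≤ (1 - κ * Ω) * aK / (64 * M * hh) := by positivity
    calc Real.sqrt g₀ ≤ Real.sqrt (((1 - κ * Ω) * aK / (64 * M * hh)) ^ 2) := Real.sqrt_le_sqrt hg3
      _ = _ := Real.sqrt_sq hx
  set X : ℝ := 1 / (8 * (C' + 1) * (512 * (2 * B + 14 * C) * Ω * hh * b + 8 * M)) with hX
  have hBC : 0 ≤ 2 * B + 14 * C := by positivity
  have hden : 0 < 8 * (C' + 1) * (512 * (2 * B + 14 * C) * Ω * hh * b + 8 * M) := by positivity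
  have hX0 : 0 ≤ X := by rw [hX]; positivity
  have hsq4 : Real.sqrt g₀ ≤ X := by
    have : g₀ ≤ X ^ 2 := hg4.trans (by linarith [sq_nonneg X])
    calc Real.sqrt g₀ ≤ Real.sqrt (X ^ 2) := Real.sqrt_le_sqrt this
      _ = X := Real.sqrt_sq hX0
  -- the smallness conditions with `θ = θ₀ = (1 + κΩ)/2`
  have hθ0 : 0 ≤ θ₀ := by rw [hθ₀]; positivity
  have hθ1 : θ₀ < 1 := by rw [hθ₀]; linarith
  have hθhalf : 1 / 2 ≤ θ₀ := by
    have hk : 0 ≤ κ * Ω := by positivity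
    rw [hθ₀]; linarith only [hk]
  have hlipK : lipK Ω B g₀ κ M hh aK ≤ θ₀ := by
    unfold lipK
    have ht : 4 * M * epsLog g₀ * hh / aK ≤ (1 - κ * Ω) / 8 := by
      rw [div_le_iff₀ haK]
      calc 4 * M * epsLog g₀ * hh ≤ 4 * M * (2 * Real.sqrt g₀) * hh := by gcongr
        _ ≤ 4 * M * (2 * ((1 - κ * Ω) * aK / (64 * M * hh))) * hh := by gcongr
        _ = (1 - κ * Ω) / 8 * aK := by field_simp; ring
    rw [hθ₀]; linarith only [hϑκ, ht, h1κ]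
  have t1 : C' * (M * aK * stepRatio Ω B g₀ / hh) ≤ 1 / 8 := by
    rw [mul_div_assoc', div_le_iff₀ hh0]
    have hMaK : 0 ≤ M * aK := by positivity
    have s1 : C' * (M * aK * stepRatio Ω B g₀) ≤ C' * (M * aK * (2 * Ω)) :=
      mul_le_mul_of_nonneg_left (mul_le_mul_of_nonneg_left hϑ2 hMaK) hC'0
    have s2 : C' * (M * aK * (2 * Ω)) = (16 * C' * M * aK * Ω) / 8 := by ring
    linarith only [s1, s2, hhA]
  have t2 : C' * (8 * (2 * B + 14 * C) * Ω * epsLogSq g₀ * hh * b + 4 * M * epsLog g₀) ≤ 1 / 8 := by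
    have hq0 : 0 ≤ (2 * B + 14 * C) * Ω * hh * b := mul_nonneg (mul_nonneg (mul_nonneg hBC hΩ0.le) hh0.le) hb.le
    have hC'1 : 0 ≤ C' + 1 := by linarith only [hC'0]
    have hs0 : 0 ≤ 256 * ((2 * B + 14 * C) * Ω * hh * b) + 8 * M := by linarith only [hq0, hM]
    have a1 : C' * (256 * ((2 * B + 14 * C) * Ω * hh * b) + 8 * M) ≤ (C' + 1) * (512 * ((2 * B + 14 * C) * Ω * hh * b) + 8 * M) :=
      mul_le_mul (by linarith only []) (by linarith only [hq0]) hs0 hC'1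
    have l1 : 8 * (2 * B + 14 * C) * Ω * epsLogSq g₀ * hh * b ≤ 8 * ((2 * B + 14 * C) * Ω * hh * b) * (32 * Real.sqrt g₀) := by
      have e : 8 * (2 * B + 14 * C) * Ω * epsLogSq g₀ * hh * b = 8 * ((2 * B + 14 * C) * Ω * hh * b) * epsLogSq g₀ := by ring
      rw [e]
      exact mul_le_mul_of_nonneg_left hε2 (by linarith only [hq0])
    have l2 : 4 * M * epsLog g₀ ≤ 4 * M * (2 * Real.sqrt g₀) := mul_le_mul_of_nonneg_left hε1 (by linarith only [hM])
    have l3 : C' * (8 * (2 * B + 14 * C) * Ω * epsLogSq g₀ * hh * b + 4 * M * epsLog g₀) ≤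
        C' * (256 * ((2 * B + 14 * C) * Ω * hh * b) + 8 * M) * Real.sqrt g₀ := by
      have e : C' * (8 * ((2 * B + 14 * C) * Ω * hh * b) * (32 * Real.sqrt g₀) + 4 * M * (2 * Real.sqrt g₀)) =
          C' * (256 * ((2 * B + 14 * C) * Ω * hh * b) + 8 * M) * Real.sqrt g₀ := by ring
      rw [← e]
      exact mul_le_mul_of_nonneg_left (add_le_add l1 l2) hC'0
    have l4 : C' * (256 * ((2 * B + 14 * C) * Ω * hh * b) + 8 * M) * Real.sqrt g₀ ≤
        (C' + 1) * (512 * ((2 * B + 14 * C) * Ω * hh * b) + 8 * M) * X :=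
      mul_le_mul a1 hsq4 hsg0 (mul_nonneg hC'1 (by linarith only [hq0, hM]))
    have l5 : (C' + 1) * (512 * ((2 * B + 14 * C) * Ω * hh * b) + 8 * M) * X = 1 / 8 := by
      rw [hX]
      have e : 512 * (2 * B + 14 * C) * Ω * hh * b = 512 * ((2 * B + 14 * C) * Ω * hh * b) := by ring
      rw [e]
      field_simp
    linarith only [l3, l4, l5]

  -- the `𝒱`-rows at level `b` and at level `β ≤ 2b`
  have hβ0 : 0 < β := lt_of_lt_of_le hb hbβ
  have hLN : 0 ≤ lipN Ω B C g₀ M hh aK b := by unfold lipN; positivity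
  have hLNβ : 0 ≤ lipN Ω B C g₀ M hh aK β := by unfold lipN; positivity
  have hlipN : ‖S‖ * lipN Ω B C g₀ M hh aK b ≤ θ₀ := by
    calc ‖S‖ * lipN Ω B C g₀ M hh aK b ≤ C' * lipN Ω B C g₀ M hh aK b := mul_le_mul_of_nonneg_right hSn hLN
      _ = C' * (M * aK * stepRatio Ω B g₀ / hh) +
          C' * (8 * (2 * B + 14 * C) * Ω * epsLogSq g₀ * hh * b + 4 * M * epsLog g₀) := by unfold lipN; ring
      _ ≤ 1 / 8 + 1 / 8 := add_le_add t1 t2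
      _ ≤ θ₀ := by linarith only [hθhalf]
  have t2β : C' * (8 * (2 * B + 14 * C) * Ω * epsLogSq g₀ * hh * β + 4 * M * epsLog g₀) ≤ 1 / 4 := by
    have hx : 0 ≤ C' * (4 * M * epsLog g₀) := by positivity
    have hk : 0 ≤ C' * (8 * (2 * B + 14 * C) * Ω * epsLogSq g₀ * hh) := by positivity
    have m1 : C' * (8 * (2 * B + 14 * C) * Ω * epsLogSq g₀ * hh) * β ≤ C' * (8 * (2 * B + 14 * C) * Ω * epsLogSq g₀ * hh) * (2 * b) :=
      mul_le_mul_of_nonneg_left hβ2 hk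
    have e1 : C' * (8 * (2 * B + 14 * C) * Ω * epsLogSq g₀ * hh * β + 4 * M * epsLog g₀) =
        C' * (8 * (2 * B + 14 * C) * Ω * epsLogSq g₀ * hh) * β + C' * (4 * M * epsLog g₀) := by ring
    have e2 : C' * (8 * (2 * B + 14 * C) * Ω * epsLogSq g₀ * hh * b + 4 * M * epsLog g₀) =
        C' * (8 * (2 * B + 14 * C) * Ω * epsLogSq g₀ * hh) * b + C' * (4 * M * epsLog g₀) := by ring
    linarith only [m1, e1, e2, t2, hx]
  have hlipNβ : ‖S‖ * lipN Ω B C g₀ M hh aK β ≤ θ₀ := by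
    calc ‖S‖ * lipN Ω B C g₀ M hh aK β ≤ C' * lipN Ω B C g₀ M hh aK β := mul_le_mul_of_nonneg_right hSn hLNβ
      _ = C' * (M * aK * stepRatio Ω B g₀ / hh) +
          C' * (8 * (2 * B + 14 * C) * Ω * epsLogSq g₀ * hh * β + 4 * M * epsLog g₀) := by unfold lipN; ring
      _ ≤ 1 / 8 + 1 / 4 := add_le_add t1 t2β
      _ ≤ θ₀ := by linarith only [hθhalf]
  -- the self-mapping, with margin `(1-θ₀)(β-b)` at level `β`
  have hSM : ‖S‖ * (M / hh) ≤ (1 - θ₀) * b := by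
    have t : C' * (M / hh) ≤ (1 - κ * Ω) * b / 2 := by
      rw [mul_div_assoc', div_le_iff₀ hh0]
      have h1 := (div_le_iff₀ (by positivity : 0 < (1 - κ * Ω) * b)).1 hhB
      have e3 : (1 - κ * Ω) * b / 2 * hh = hh * ((1 - κ * Ω) * b) / 2 := by ring
      linarith only [h1, e3]
    have h2 : ‖S‖ * (M / hh) ≤ C' * (M / hh) := mul_le_mul_of_nonneg_right hSn (by positivity)
    have e2 : (1 - θ₀) * b = (1 - κ * Ω) * b / 2 := by rw [hθ₀]; ring
    linarith only [t, h2, e2]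
  have hball : ‖S‖ * (M / hh) + θ₀ * b ≤ b := by linarith only [hSM]
  have hballβ : ‖S‖ * (M / hh) + θ₀ * β + (1 - θ₀) * (β - b) ≤ β := by linarith only [hSM]
  have hm0 : 0 ≤ (1 - θ₀) * (β - b) := mul_nonneg (by linarith only [hθ1]) (by linarith only [hbβ])
  have hballβ' : ‖S‖ * (M / hh) + θ₀ * β ≤ β := by linarith only [hballβ, hm0]
  have hSmall : CutoffQuadHyp.SmallHyp Ω B C g₀ κ M hh aK b θ₀ S := ⟨hθ0, hθ1, hlipK, hlipN, hball⟩
  have hSmallβ : CutoffQuadHyp.SmallHyp Ω B C g₀ κ M hh aK β θ₀ S := ⟨hθ0, hθ1, hlipK, hlipNβ, hballβ'⟩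
  have hBallβ : CutoffQuadHyp.BallHyp P ψ Ω (jOmega P.β Ω) g₀ hh a aStar β K₀ :=
    ⟨hh0, by linarith, hβ1, ha0.le, ha, hKbar, hsmall1, hsmall2⟩
  have hκϑ : κ * stepRatio Ω B g₀ ≤ θ₀ := by
    have h0 : 0 ≤ 4 * M * epsLog g₀ * hh / aK := by positivity
    have h' := hlipK; unfold lipK at h'; linarith only [h0, h']
  exact ⟨h, hBall, hBallβ, hSmall, ⟨hSmallβ, hm0, hballβ⟩, hκϑ⟩

/-! ## Theorem 1.4(ii): the critical flow is differentiable in `g₀`, with the bound (1.15) -/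

section Derivative

variable {Mext : Type*}
variable {W : ℕ → Type*} [∀ j, NormedAddCommGroup (W j)] [∀ j, NormedSpace ℝ (W j)] [∀ j, CompleteSpace (W j)]
variable (ψf : ∀ m : Mext, ∀ j, W j × V3 → W (j + 1)) (ρf : ∀ m : Mext, ∀ j, W j × V3 → V3)
variable {Pf : Mext → QuadFlowParams} {Ω B c lam C a κ R M aStar b hh : ℝ}

/-- `g_* ≤` the threshold of (A1)–(A2) packaging. [cite: BauerschmidtBrydgesSlade2015Flow, Theorem 1.4] -/
theorem gThreshold_le_quadThreshold :
    gThreshold Ω B c C lam M a aStar κ R b hh ≤ quadThreshold Ω B c C lam :=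
  (min_le_left _ _).trans ((min_le_left _ _).trans (min_le_left _ _))

set_option maxHeartbeats 800000 in
/-- **[BBS-rg-flow, Theorem 1.4(ii), differentiability] = BBS 2015, Theorem 7.2.1(ii)**: let the
constants satisfy the standing inequalities with `𝗁 ≥ 𝗁_*` (`ConstHyp`), (A1)–(A2) for every external
parameter, and let `(m, K₀, g)` be admissible for all `g` near `g₀` (`0 < g ≤ g_*`, `‖K₀‖ ≤ a_*g³`, (A3)
along `V̄(g)`; e.g. `K₀ = 0` and `g₀ < g_*`), with the smallness `8B²C_{2,0}g₀ < 1` of Lemma 2.3. Then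
every scale `x_j(m, K₀, ·) = (K_j, V_j)` of the critical flow of Theorem 1.4(i) is differentiable at `g₀`,
with derivative `physXL_j(v_j)` where `v` — the derivative at `0` of the fixed point of the affine family
at the frozen base point `g₀` — obeys `‖v‖ ≤ K_e/((1-θ₀)𝗁g₀²|log g₀|)`, `θ₀ = (1+κΩ)/2`.
(`K₀` is held fixed; the joint `C¹`-regularity in `(K₀, g₀)` of the printed statement is not
addressed — TODO(general form).) [cite: BauerschmidtBrydgesSlade2015Flow, Theorem 1.4(ii) and its proof (§3.4)] [cite: BauerschmidtBrydgesSlade2015LogCorr, Theorem 7.2.1(ii)] -/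
theorem hasDerivAt_critFlow (hc : ConstHyp Ω c lam C a κ R M aStar b hh)
    (hA : ∀ m, HypA1 (Pf m).β Ω B c ∧ HypA2 (Pf m) Ω lam c C) {m : Mext} {K₀ : W 0} {g₀ : ℝ}
    (hsmallD : 8 * B ^ 2 * ((1 + (⌊c⁻¹⌋₊ : ℝ)) / c + ⌊c⁻¹⌋₊ + 2 * Ω / (Ω - 1)) * g₀ < 1)
    (hadm : ∀ᶠ g in 𝓝 g₀, Adm Pf ψf ρf Ω B c lam C a κ R M aStar b hh (m, K₀, g)) :
    ∃ v : SeqK W × SeqV,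
      ‖v‖ ≤ modeVConst Ω c ⌊c⁻¹⌋₊ C lam / (hh * g₀ ^ 2 * |Real.log g₀|) / (1 - (1 + κ * Ω) / 2) ∧
      ∀ j, HasDerivAt (fun g => critFlow ψf ρf hc hA (m, K₀, g) j)
        (physXL (Pf m) Ω (jOmega (Pf m).β Ω) g₀ hh (a - aStar) j ((v.1 : ∀ j, W j) j, (v.2 : ℕ → V3) j)) g₀ := by
  -- admissibility at `g₀` and the constants
  obtain ⟨hg₀, hgs', hK₀, hA3⟩ := hadm.self_of_nhds
  have hb := hc.b_pos; have hb1 := hc.b_lt; have hκΩ := hc.κΩ_lt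
  have hθ1 : (1 + κ * Ω) / 2 < 1 := by linarith
  obtain ⟨β, hβ⟩ : ∃ β : ℝ, β = min ((1 + b) / 2) (2 * b) := ⟨_, rfl⟩
  have hbβ : b < β := by rw [hβ]; exact lt_min (by linarith) (by linarith)
  have hβ2 : β ≤ 2 * b := by rw [hβ]; exact min_le_right _ _
  have hβ1 : β < 1 := by rw [hβ]; exact (min_le_left _ _).trans_lt (by linarith)
  obtain ⟨h, hB, hBβ, -, hmH, hκϑ⟩ := marginHyp_of_thresholds hc.one_lt_Ω hc.κ_pos hc.κΩ_lt hc.R_pos hc.M_pos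
    hc.aStar_gt hc.aStar_lt hb hb1 hh hc.hh_ge (Pf m) (ψf m) (ρf m) (hA m).1 (hA m).2 hg₀ hgs' hA3 hK₀ hbβ.le hβ2 hβ1.le
  have hm0 : 0 < (1 - (1 + κ * Ω) / 2) * (β - b) := mul_pos (by linarith) (by linarith)
  have hh0 := hB.hh_pos
  -- the direction `E` and the derivative of the fixed point at `0`
  have hE := h.norm_modeVec_le (W := W) hh0
  obtain ⟨T', v, -, -, -, hvle, hderiv⟩ := h.hasStrictDerivAt_affFix hA3 hBβ hβ1 hmH (p₀ := 0)
    (by rw [abs_zero, zero_mul]; exact hm0)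
  refine ⟨v, hvle.trans (div_le_div_of_nonneg_right hE (by linarith)), fun j => ?_⟩
  -- the transfer data
  have hM := hc.M_pos.le
  have haK : 0 < a - aStar := by linarith [hc.aStar_lt]
  obtain ⟨hs1, hs2, hs3, hLeq⟩ := h.transferSlope_parts (lam := lam) (M := M) (aK := a - aStar)
    (θ := (1 + κ * Ω) / 2) (b := b) hM hh0 haK hθ1 hb.le
  have hL0 : 0 ≤ transferSlope Ω c ⌊c⁻¹⌋₊ C lam g₀ M hh (a - aStar) ((1 + κ * Ω) / 2) b := by rw [hLeq]; positivity
  obtain ⟨δT, hδT⟩ : ∃ δT : ℝ, δT = min (g₀ / 36)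
      ((β - b) / (transferSlope Ω c ⌊c⁻¹⌋₊ C lam g₀ M hh (a - aStar) ((1 + κ * Ω) / 2) b + 1)) := ⟨_, rfl⟩
  have hδT0 : 0 < δT := by rw [hδT]; exact lt_min (by linarith) (div_pos (by linarith) (by linarith))
  have hδT1 : δT ≤ g₀ / 36 := by rw [hδT]; exact min_le_left _ _
  have hLδ : transferSlope Ω c ⌊c⁻¹⌋₊ C lam g₀ M hh (a - aStar) ((1 + κ * Ω) / 2) b * δT ≤ β - b := by
    have h1 : δT ≤ (β - b) / (transferSlope Ω c ⌊c⁻¹⌋₊ C lam g₀ M hh (a - aStar) ((1 + κ * Ω) / 2) b + 1) := by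
      rw [hδT]; exact min_le_right _ _
    have h2 := mul_le_mul_of_nonneg_left h1 hL0
    refine h2.trans ?_
    rw [mul_div_assoc', div_le_iff₀ (by linarith)]
    nlinarith only [hL0, hbβ]
  -- the eventual conditions on `g`
  have e2 : ∀ᶠ g in 𝓝 g₀, |g - g₀| < δT := eventually_abs_sub_lt g₀ hδT0
  have e3 : ∀ᶠ g in 𝓝 g₀, |g - g₀| * ‖modeVec W (Pf m) Ω (jOmega (Pf m).β Ω) g₀ hh‖ < (1 - (1 + κ * Ω) / 2) * (β - b) := by
    have hE0 := norm_nonneg (modeVec W (Pf m) Ω (jOmega (Pf m).β Ω) g₀ hh)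
    have hε : 0 < (1 - (1 + κ * Ω) / 2) * (β - b) / (‖modeVec W (Pf m) Ω (jOmega (Pf m).β Ω) g₀ hh‖ + 1) := by positivity
    filter_upwards [eventually_abs_sub_lt g₀ hε] with g hg
    rw [lt_div_iff₀ (by positivity)] at hg
    nlinarith only [hg, hE0, abs_nonneg (g - g₀)]
  have e4 : ∀ᶠ g in 𝓝 g₀, 8 * B ^ 2 * ((1 + (⌊c⁻¹⌋₊ : ℝ)) / c + ⌊c⁻¹⌋₊ + 2 * Ω / (Ω - 1)) * max g g₀ < 1 := by
    have hcont : Continuous fun g : ℝ => 8 * B ^ 2 * ((1 + (⌊c⁻¹⌋₊ : ℝ)) / c + ⌊c⁻¹⌋₊ + 2 * Ω / (Ω - 1)) * max g g₀ :=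
      continuous_const.mul (continuous_id.max continuous_const)
    exact hcont.continuousAt.eventually_lt continuousAt_const (by rw [max_self]; exact hsmallD)
  -- the identification with the fixed point of the affine family, for `g` near `g₀`
  have hident : ∀ᶠ g in 𝓝 g₀, critFlow ψf ρf hc hA (m, K₀, g) j =
      physX (Pf m) (ψf m) Ω (jOmega (Pf m).β Ω) g₀ hh (a - aStar) K₀ j
        ((affFix (Pf m) (ψf m) (ρf m) Ω (jOmega (Pf m).β Ω) g₀ hh (a - aStar) K₀ (h.sbarVP hB.small1 hB.hh_pos) β (g - g₀)).1 j,
         (affFix (Pf m) (ψf m) (ρf m) Ω (jOmega (Pf m).β Ω) g₀ hh (a - aStar) K₀ (h.sbarVP hB.small1 hB.hh_pos) β (g - g₀)).2 j) := by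
    filter_upwards [hadm, e2, e3, e4] with g hq hδ hpE h8
    have hgpos : 0 < g := hq.1
    have hgle : g ≤ gThreshold Ω B c C lam M a aStar κ R b hh := hq.2.1
    obtain ⟨-, hflow, hK0, hg0, tz, tμ, hbd, -⟩ := critFlow_spec ψf ρf hc hA (q := (m, K₀, g)) hq
    -- (A1)–(A2) packaged at `max g g₀`
    have hmaxle : max g g₀ ≤ quadThreshold Ω B c C lam :=
      (max_le hgle hgs').trans gThreshold_le_quadThreshold
    have hmax := (cutoffQuadHyp_of_hypA hc.one_lt_Ω (hA m).1 (hA m).2 (lt_max_of_lt_right hg₀) hmaxle).1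
    -- transfer of the bounds to the base point `g₀` at level `β`
    have hbdβ := h.flowBounds_transfer hA3 hh0 hc.aStar_lt hB.Kbar_le hκϑ hθ1 hgpos hmax h8.le hδ.le hδT1
      hb.le hβ1.le hLδ hbd
    obtain ⟨y, hy, hy1, hy2⟩ := h.unscale_mem hBβ hbdβ
    have hg0' : (critFlow ψf ρf hc hA (m, K₀, g) 0).2 0 = g₀ + (g - g₀) := by
      rw [hg0]; show g = g₀ + (g - g₀); ring
    have hfix := h.Ttil_eq_of_flow hA3 hBβ hflow hK0 hg0' tz tμ hy hy1 hy2
    have hyEq := h.eq_affFix_of_fixedPoint hA3 hBβ hmH hpE.le hy hfix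
    have hph := h.physX_unscale hBβ (critFlow ψf ρf hc hA (m, K₀, g)) j
    rw [← hy1, ← hy2, hyEq] at hph
    exact hph.symm
  -- the derivative of the model function `g ↦ x̄_j + physXL_j((affFix (g - g₀))_j)`
  have hF : HasDerivAt (fun g => physX (Pf m) (ψf m) Ω (jOmega (Pf m).β Ω) g₀ hh (a - aStar) K₀ j
        ((affFix (Pf m) (ψf m) (ρf m) Ω (jOmega (Pf m).β Ω) g₀ hh (a - aStar) K₀ (h.sbarVP hB.small1 hB.hh_pos) β (g - g₀)).1 j,
         (affFix (Pf m) (ψf m) (ρf m) Ω (jOmega (Pf m).β Ω) g₀ hh (a - aStar) K₀ (h.sbarVP hB.small1 hB.hh_pos) β (g - g₀)).2 j))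
      (physXL (Pf m) Ω (jOmega (Pf m).β Ω) g₀ hh (a - aStar) j ((v.1 : ∀ j, W j) j, (v.2 : ℕ → V3) j)) g₀ := by
    have h1 : HasDerivAt (affFix (Pf m) (ψf m) (ρf m) Ω (jOmega (Pf m).β Ω) g₀ hh (a - aStar) K₀ (h.sbarVP hB.small1 hB.hh_pos) β)
        v (g₀ - g₀) := by rw [sub_self]; exact hderiv.hasDerivAt
    have h2 := HasDerivAt.comp_sub_const g₀ g₀ h1
    have h3 := ((physXL (W := W) (Pf m) Ω (jOmega (Pf m).β Ω) g₀ hh (a - aStar) j ∘L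
      ((lpEval (E := W) j ∘L ContinuousLinearMap.fst ℝ (SeqK W) SeqV).prod
        (lpEval (E := fun _ : ℕ => V3) j ∘L ContinuousLinearMap.snd ℝ (SeqK W) SeqV))).hasFDerivAt).comp_hasDerivAt g₀ h2
    have h4 := h3.const_add (baseX (Pf m) (ψf m) g₀ K₀ j)
    refine HasDerivAt.congr_of_eventuallyEq (h4.congr_deriv rfl) (Filter.Eventually.of_forall fun g => ?_)
    dsimp only [Function.comp_def]
    rw [physX_eq_baseX_add]
    rfl
  exact hF.congr_of_eventuallyEq hident

/-- **[BBS-rg-flow, Theorem 1.4(ii), the bound (1.15)] = BBS 2015, Theorem 7.2.1(ii)**: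
`|∂z₀/∂g₀| ≤ 2K_e/(1-κΩ)` and `|∂μ₀/∂g₀| ≤ 2K_e/(1-κΩ)` at every `g₀` as in `hasDerivAt_critFlow` — a
constant depending only on the constants of (A1)–(A3) (through `K_e = modeVConst(Ω, c, ⌊c⁻¹⌋, C, λ)` and
`κΩ`), uniformly in `g₀`, `𝗁` and the external parameter: from `‖v‖ ≤ K_e/((1-θ₀)𝗁g₀²|log g₀|)` and
the weight `𝗐_{z,0} = 𝗐_{μ,0} = 𝗁χ₀g₀²|log g₀|`. [cite: BauerschmidtBrydgesSlade2015Flow, Theorem 1.4(ii), (1.15) ("∂z₀/∂g₀ = O(1), ∂μ₀/∂g₀ = O(1)")] [cite: BauerschmidtBrydgesSlade2015LogCorr, Theorem 7.2.1(ii)] -/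
theorem abs_deriv_critFlow_zero_le (hc : ConstHyp Ω c lam C a κ R M aStar b hh)
    (hA : ∀ m, HypA1 (Pf m).β Ω B c ∧ HypA2 (Pf m) Ω lam c C) {m : Mext} {K₀ : W 0} {g₀ : ℝ}
    (hsmallD : 8 * B ^ 2 * ((1 + (⌊c⁻¹⌋₊ : ℝ)) / c + ⌊c⁻¹⌋₊ + 2 * Ω / (Ω - 1)) * g₀ < 1)
    (hadm : ∀ᶠ g in 𝓝 g₀, Adm Pf ψf ρf Ω B c lam C a κ R M aStar b hh (m, K₀, g)) :
    DifferentiableAt ℝ (fun g => (critFlow ψf ρf hc hA (m, K₀, g) 0).2 1) g₀ ∧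
      DifferentiableAt ℝ (fun g => (critFlow ψf ρf hc hA (m, K₀, g) 0).2 2) g₀ ∧
      |deriv (fun g => (critFlow ψf ρf hc hA (m, K₀, g) 0).2 1) g₀| ≤ 2 * modeVConst Ω c ⌊c⁻¹⌋₊ C lam / (1 - κ * Ω) ∧
      |deriv (fun g => (critFlow ψf ρf hc hA (m, K₀, g) 0).2 2) g₀| ≤ 2 * modeVConst Ω c ⌊c⁻¹⌋₊ C lam / (1 - κ * Ω) := by
  obtain ⟨v, hv, hD⟩ := hasDerivAt_critFlow ψf ρf hc hA hsmallD hadm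
  obtain ⟨hg₀, hgs', -, -⟩ := hadm.self_of_nhds
  have hκΩ := hc.κΩ_lt
  obtain ⟨h, -, -⟩ := cutoffQuadHyp_of_hypA hc.one_lt_Ω (hA m).1 (hA m).2 hg₀ (hgs'.trans gThreshold_le_quadThreshold)
  have hh1 : 1 ≤ hh := (one_le_hThreshold Ω c C lam M a aStar κ b).trans hc.hh_ge
  have hh0 : 0 < hh := by linarith
  have hL0 : 0 < |Real.log g₀| := by
    have : Real.log g₀ < 0 := Real.log_neg hg₀ (by linarith [h.g₀_le])
    exact abs_pos.2 this.ne
  have hden : 0 < hh * g₀ ^ 2 * |Real.log g₀| := by positivity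
  have hKe0 : 0 ≤ modeVConst Ω c ⌊c⁻¹⌋₊ C lam := by
    have := (norm_nonneg _).trans (h.norm_modeV_le hh0 0)
    rwa [le_div_iff₀ hden, zero_mul] at this
  have hw0 := (h.weight_pos 0).le; have hw1 := h.weight_le_one 0
  -- the coordinate derivatives
  have hπ : ∀ i : Fin 3, HasDerivAt (fun g => (critFlow ψf ρf hc hA (m, K₀, g) 0).2 i)
      ((physXL (Pf m) Ω (jOmega (Pf m).β Ω) g₀ hh (a - aStar) 0 ((v.1 : ∀ j, W j) 0, (v.2 : ℕ → V3) 0)).2 i) g₀ := by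
    intro i
    have := (((ContinuousLinearMap.proj i).comp (ContinuousLinearMap.snd ℝ (W 0) V3)).hasFDerivAt).comp_hasDerivAt g₀ (hD 0)
    exact this
  have hval : ∀ i : Fin 3, i ≠ 0 → (physXL (Pf m) Ω (jOmega (Pf m).β Ω) g₀ hh (a - aStar) 0 ((v.1 : ∀ j, W j) 0, (v.2 : ℕ → V3) 0)).2 i =
      (Pf m).wZ g₀ Ω (jOmega (Pf m).β Ω) hh 0 * (v.2 : ℕ → V3) 0 i := by
    intro i hi
    fin_cases i
    · exact absurd rfl hi
    · rfl
    · rfl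
  have hbound : ∀ i : Fin 3, i ≠ 0 →
      |(physXL (Pf m) Ω (jOmega (Pf m).β Ω) g₀ hh (a - aStar) 0 ((v.1 : ∀ j, W j) 0, (v.2 : ℕ → V3) 0)).2 i| ≤
        2 * modeVConst Ω c ⌊c⁻¹⌋₊ C lam / (1 - κ * Ω) := by
    intro i hi
    rw [hval i hi, abs_mul]
    have hvi : |(v.2 : ℕ → V3) 0 i| ≤ ‖v‖ := (abs_apply_le_norm_seqV v.2 0 i).trans (norm_snd_le v)
    have hwZ : |(Pf m).wZ g₀ Ω (jOmega (Pf m).β Ω) hh 0| = hh * (cutoffWeight Ω (jOmega (Pf m).β Ω) 0 * g₀ ^ 2 * |Real.log g₀|) := by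
      rw [abs_of_pos (h.wZ_pos hh0 0)]; simp [QuadFlowParams.wZ]
    rw [hwZ]
    have hθ : 1 - (1 + κ * Ω) / 2 = (1 - κ * Ω) / 2 := by ring
    rw [hθ] at hv
    calc hh * (cutoffWeight Ω (jOmega (Pf m).β Ω) 0 * g₀ ^ 2 * |Real.log g₀|) * |(v.2 : ℕ → V3) 0 i|
        ≤ hh * (1 * g₀ ^ 2 * |Real.log g₀|) * (modeVConst Ω c ⌊c⁻¹⌋₊ C lam / (hh * g₀ ^ 2 * |Real.log g₀|) / ((1 - κ * Ω) / 2)) := by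
          apply mul_le_mul _ (hvi.trans hv) (abs_nonneg _) (by positivity)
          gcongr
      _ = 2 * modeVConst Ω c ⌊c⁻¹⌋₊ C lam / (1 - κ * Ω) := by
          field_simp
  refine ⟨(hπ 1).differentiableAt, (hπ 2).differentiableAt, ?_, ?_⟩
  · rw [(hπ 1).deriv]; exact hbound 1 (by decide)
  · rw [(hπ 2).deriv]; exact hbound 2 (by decide)

end Derivative

end CTWSAW

end Literature.Barriers.CriticalPhenomena
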